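import Summits.NavierStokesRegularity.NavierStokesRegularity.Theorems.ExtremiserTransienceNearExtremalTransienceExtremiserLiouvilleConstantSpeedSlideStretchingAxial
import HarnessLib

/-!
# Crux `ExtremiserTransience.NearExtremalTransience` (stmt-NavierStokesRegularity-21883), line `extremiser_liouville`,
# stub K1b — POINTWISE BOUNDS FOR THE CUBIC AND THE `g″`-CROSS DENSITIES OF (INEQ)₃ (R6b bookkeeping, record §15/§17/§18)

`--supports stmt-NavierStokesRegularity-21883` (helper).  Author: prover seat `ns-el-k1b` (g9).

The densities of `slideInequality_layer` (`…ConstantSpeedSlideInequalityLayer`) that carry NO second-order identity are absorbed in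
R6b by Cauchy–Schwarz; this file records their pointwise sizes in terms of `‖DV‖`, `‖ω‖` (`ω = curl V`) and the zeroth-order vector
`Y` (`= v(x) − c` in (INEQ)₃), with the integrand shapes of (INEQ)₃:
* `abs_inner_curl_fderiv_curl_le` : `|⟪ω, DVω⟫| ≤ ‖DV‖‖ω‖²`;
* `abs_stretchingTangent_le` : `|T_A| ≤ 8‖DV‖²‖ω‖ + 5‖DV‖‖ω‖²` (`T_A` the `g′`-density of the `J`-line, `A = (−2∂₂V₁, 2∂₂V₀, ω₂)`);
* `abs_stretchingCross_le` : `|T_B| ≤ 2‖Y‖‖DV‖‖ω‖ + 2‖Y‖‖ω‖²` (`T_B` the `g″`-density, `B = (−Y₁, Y₀, 0)`);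
* `norm_fderiv_crossField_apply_le` : `‖∂_wB‖ ≤ ‖∂_wV‖` for the cross FIELD `B = (−V₁, V₀, 0)`;
* `abs_inner_fderiv_curl_fderiv_crossField_le`, `abs_slideCoeff_density_le` : the `g″`-densities `⟪∂_uω, ∂_wB⟫` and
  `(∂₂ω)₀(∂₁V)₂ − (∂₂ω)₁(∂₀V)₂` are `≤ ‖∂_uω‖‖∂_wV‖` and `≤ 2‖∂₂ω‖‖DV‖`.

WHAT THIS IS NOT: K1b is NOT proved; nothing here proves NS regularity. [folklore]
-/

noncomputable section

open Set Filter Topology MeasureTheory Metric Function InnerProductSpace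
open scoped ENNReal NNReal Topology InnerProductSpace RealInnerProductSpace ContDiff
open Literature.Analysis.FluidPDE Literature.Analysis

namespace Summit.NavierStokesRegularity.NavierStokesRegularity.Theorems

-- the problem directory repeats the summit name (`NavierStokesRegularity/NavierStokesRegularity`)
set_option linter.dupNamespace false

namespace ExtremiserLiouville

open DepletionLadder.KStar

variable {V : EuclideanSpace ℝ (Fin 3) → EuclideanSpace ℝ (Fin 3)}

/-! ## 1. The cubic densities of the `J`-line -/

/-- `|⟪ω, DVω⟫| ≤ ‖DV‖‖ω‖²`. [folklore] -/
theorem abs_inner_curl_fderiv_curl_le (x : EuclideanSpace ℝ (Fin 3)) :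
    |⟪curl V x, fderiv ℝ V x (curl V x)⟫| ≤ ‖fderiv ℝ V x‖ * ‖curl V x‖ ^ 2 := by
  refine (abs_real_inner_le_norm _ _).trans ?_
  have h := (fderiv ℝ V x).le_opNorm (curl V x)
  nlinarith [norm_nonneg (curl V x), h]

/-- **`|T_A| ≤ 8‖DV‖²‖ω‖ + 5‖DV‖‖ω‖²`** for the `g′`-weighted cubic density of the `J`-line of (INEQ)₃,
`T_A = ⟪A,DVω⟫ + ω₂⟪ω,∂₂V⟫ + ⟪ω, DVω − (DVω)₂e₂⟫ + ⟪ω, DV A⟫`, `A = (−2∂₂V₁, 2∂₂V₀, ω₂)`. [folklore] -/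
theorem abs_stretchingTangent_le (x : EuclideanSpace ℝ (Fin 3)) :
    |(⟪((-2 * fderiv ℝ V x (EuclideanSpace.single (2 : Fin 3) (1 : ℝ)) 1) • EuclideanSpace.single (0 : Fin 3) (1 : ℝ) + (2 * fderiv ℝ V x (EuclideanSpace.single (2 : Fin 3) (1 : ℝ)) 0) • EuclideanSpace.single (1 : Fin 3) (1 : ℝ) + (curl V x 2) • EuclideanSpace.single (2 : Fin 3) (1 : ℝ)), fderiv ℝ V x (curl V x)⟫ + curl V x 2 * ⟪curl V x, fderiv ℝ V x (EuclideanSpace.single (2 : Fin 3) (1 : ℝ))⟫ + ⟪curl V x, fderiv ℝ V x (curl V x) - (fderiv ℝ V x (curl V x) 2) • EuclideanSpace.single (2 : Fin 3) (1 : ℝ)⟫ + ⟪curl V x, fderiv ℝ V x ((-2 * fderiv ℝ V x (EuclideanSpace.single (2 : Fin 3) (1 : ℝ)) 1) • EuclideanSpace.single (0 : Fin 3) (1 : ℝ) + (2 * fderiv ℝ V x (EuclideanSpace.single (2 : Fin 3) (1 : ℝ)) 0) • EuclideanSpace.single (1 : Fin 3) (1 : ℝ) + (curl V x 2) • EuclideanSpace.single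 (2 : Fin 3) (1 : ℝ))⟫)| ≤ 8 * ‖fderiv ℝ V x‖ ^ 2 * ‖curl V x‖ + 5 * ‖fderiv ℝ V x‖ * ‖curl V x‖ ^ 2 := by
  have hA := norm_slideA_le (V := V) x
  have hP := norm_nonneg (fderiv ℝ V x)
  have hW := norm_nonneg (curl V x)
  have n2 : ‖(EuclideanSpace.single (2 : Fin 3) (1 : ℝ) : EuclideanSpace ℝ (Fin 3))‖ = 1 := by rw [PiLp.norm_single, norm_one]
  have hDω : ‖fderiv ℝ V x (curl V x)‖ ≤ ‖fderiv ℝ V x‖ * ‖curl V x‖ := (fderiv ℝ V x).le_opNorm _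
  have hD2 : ‖fderiv ℝ V x (EuclideanSpace.single (2 : Fin 3) (1 : ℝ))‖ ≤ ‖fderiv ℝ V x‖ := by simpa [n2] using (fderiv ℝ V x).le_opNorm (EuclideanSpace.single (2 : Fin 3) (1 : ℝ))
  have hDA : ‖fderiv ℝ V x ((-2 * fderiv ℝ V x (EuclideanSpace.single (2 : Fin 3) (1 : ℝ)) 1) • EuclideanSpace.single (0 : Fin 3) (1 : ℝ) + (2 * fderiv ℝ V x (EuclideanSpace.single (2 : Fin 3) (1 : ℝ)) 0) • EuclideanSpace.single (1 : Fin 3) (1 : ℝ) + (curl V x 2) • EuclideanSpace.single (2 : Fin 3) (1 : ℝ))‖ ≤ ‖fderiv ℝ V x‖ * (4 * ‖fderiv ℝ V x‖ + ‖curl V x‖) :=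
    ((fderiv ℝ V x).le_opNorm _).trans (mul_le_mul_of_nonneg_left hA hP)
  have hω2 : |curl V x 2| ≤ ‖curl V x‖ := abs_apply_le_norm _ 2
  have hH : ‖fderiv ℝ V x (curl V x) - (fderiv ℝ V x (curl V x) 2) • EuclideanSpace.single (2 : Fin 3) (1 : ℝ)‖ ≤ 2 * (‖fderiv ℝ V x‖ * ‖curl V x‖) :=
    (norm_horizontalPart_le _).trans (by linarith)
  have t1 : |⟪((-2 * fderiv ℝ V x (EuclideanSpace.single (2 : Fin 3) (1 : ℝ)) 1) • EuclideanSpace.single (0 : Fin 3) (1 : ℝ) + (2 * fderiv ℝ V x (EuclideanSpace.single (2 : Fin 3) (1 : ℝ)) 0) • EuclideanSpace.single (1 : Fin 3) (1 : ℝ) + (curl V x 2) • EuclideanSpace.single (2 : Fin 3) (1 : ℝ)), fderiv ℝ V x (curl V x)⟫| ≤ (4 * ‖fderiv ℝ V x‖ + ‖curl V x‖) * (‖fderiv ℝ V x‖ * ‖curl V x‖) :=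
    (abs_real_inner_le_norm _ _).trans (mul_le_mul hA hDω (norm_nonneg _) (by positivity))
  have t2 : |curl V x 2 * ⟪curl V x, fderiv ℝ V x (EuclideanSpace.single (2 : Fin 3) (1 : ℝ))⟫| ≤ ‖curl V x‖ * (‖curl V x‖ * ‖fderiv ℝ V x‖) := by
    rw [abs_mul]
    exact mul_le_mul hω2 ((abs_real_inner_le_norm _ _).trans (mul_le_mul_of_nonneg_left hD2 hW)) (abs_nonneg _) hW
  have t3 : |⟪curl V x, fderiv ℝ V x (curl V x) - (fderiv ℝ V x (curl V x) 2) • EuclideanSpace.single (2 : Fin 3) (1 : ℝ)⟫| ≤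
      ‖curl V x‖ * (2 * (‖fderiv ℝ V x‖ * ‖curl V x‖)) :=
    (abs_real_inner_le_norm _ _).trans (mul_le_mul_of_nonneg_left hH hW)
  have t4 : |⟪curl V x, fderiv ℝ V x ((-2 * fderiv ℝ V x (EuclideanSpace.single (2 : Fin 3) (1 : ℝ)) 1) • EuclideanSpace.single (0 : Fin 3) (1 : ℝ) + (2 * fderiv ℝ V x (EuclideanSpace.single (2 : Fin 3) (1 : ℝ)) 0) • EuclideanSpace.single (1 : Fin 3) (1 : ℝ) + (curl V x 2) • EuclideanSpace.single (2 : Fin 3) (1 : ℝ))⟫| ≤ ‖curl V x‖ * (‖fderiv ℝ V x‖ * (4 * ‖fderiv ℝ V x‖ + ‖curl V x‖)) :=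
    (abs_real_inner_le_norm _ _).trans (mul_le_mul_of_nonneg_left hDA hW)
  calc |(⟪((-2 * fderiv ℝ V x (EuclideanSpace.single (2 : Fin 3) (1 : ℝ)) 1) • EuclideanSpace.single (0 : Fin 3) (1 : ℝ) + (2 * fderiv ℝ V x (EuclideanSpace.single (2 : Fin 3) (1 : ℝ)) 0) • EuclideanSpace.single (1 : Fin 3) (1 : ℝ) + (curl V x 2) • EuclideanSpace.single (2 : Fin 3) (1 : ℝ)), fderiv ℝ V x (curl V x)⟫ + curl V x 2 * ⟪curl V x, fderiv ℝ V x (EuclideanSpace.single (2 : Fin 3) (1 : ℝ))⟫ + ⟪curl V x, fderiv ℝ V x (curl V x) - (fderiv ℝ V x (curl V x) 2) • EuclideanSpace.single (2 : Fin 3) (1 : ℝ)⟫ + ⟪curl V x, fderiv ℝ V x ((-2 * fderiv ℝ V x (EuclideanSpace.single (2 : Fin 3) (1 : ℝ)) 1) • EuclideanSpace.single (0 : Fin 3) (1 : ℝ) + (2 * fderiv ℝ V x (EuclideanSpace.single (2 : Fin 3) (1 : ℝ)) 0) • EuclideanSpace.single (1 : Fin 3) (1 : ℝ) + (curl V x 2)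 • EuclideanSpace.single (2 : Fin 3) (1 : ℝ))⟫)|
      ≤ |⟪((-2 * fderiv ℝ V x (EuclideanSpace.single (2 : Fin 3) (1 : ℝ)) 1) • EuclideanSpace.single (0 : Fin 3) (1 : ℝ) + (2 * fderiv ℝ V x (EuclideanSpace.single (2 : Fin 3) (1 : ℝ)) 0) • EuclideanSpace.single (1 : Fin 3) (1 : ℝ) + (curl V x 2) • EuclideanSpace.single (2 : Fin 3) (1 : ℝ)), fderiv ℝ V x (curl V x)⟫| + |curl V x 2 * ⟪curl V x, fderiv ℝ V x (EuclideanSpace.single (2 : Fin 3) (1 : ℝ))⟫| +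
          |⟪curl V x, fderiv ℝ V x (curl V x) - (fderiv ℝ V x (curl V x) 2) • EuclideanSpace.single (2 : Fin 3) (1 : ℝ)⟫| + |⟪curl V x, fderiv ℝ V x ((-2 * fderiv ℝ V x (EuclideanSpace.single (2 : Fin 3) (1 : ℝ)) 1) • EuclideanSpace.single (0 : Fin 3) (1 : ℝ) + (2 * fderiv ℝ V x (EuclideanSpace.single (2 : Fin 3) (1 : ℝ)) 0) • EuclideanSpace.single (1 : Fin 3) (1 : ℝ) + (curl V x 2) • EuclideanSpace.single (2 : Fin 3) (1 : ℝ))⟫| := by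
        refine (abs_add_le _ _).trans (add_le_add ((abs_add_le _ _).trans (add_le_add (abs_add_le _ _) le_rfl)) le_rfl)
    _ ≤ _ := by nlinarith [t1, t2, t3, t4, mul_nonneg hP hW]

/-- **`|T_B| ≤ 2‖Y‖‖DV‖‖ω‖ + 2‖Y‖‖ω‖²`** for the `g″`-weighted density of the `J`-line of (INEQ)₃,
`T_B = ⟪B,DVω⟫ + ω₂⟪ω, Y − Y₂e₂⟫ + ⟪ω, DV B⟫`, `B = (−Y₁, Y₀, 0)` (`Y = v(x) − c` in (INEQ)₃). [folklore] -/
theorem abs_stretchingCross_le (x Y : EuclideanSpace ℝ (Fin 3)) :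
    |(⟪((-Y 1) • EuclideanSpace.single (0 : Fin 3) (1 : ℝ) + (Y 0) • EuclideanSpace.single (1 : Fin 3) (1 : ℝ)), fderiv ℝ V x (curl V x)⟫ + curl V x 2 * ⟪curl V x, Y - (Y 2) • EuclideanSpace.single (2 : Fin 3) (1 : ℝ)⟫ + ⟪curl V x, fderiv ℝ V x ((-Y 1) • EuclideanSpace.single (0 : Fin 3) (1 : ℝ) + (Y 0) • EuclideanSpace.single (1 : Fin 3) (1 : ℝ))⟫)| ≤ 2 * ‖Y‖ * ‖fderiv ℝ V x‖ * ‖curl V x‖ + 2 * ‖Y‖ * ‖curl V x‖ ^ 2 := by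
  have hB : ‖((-Y 1) • EuclideanSpace.single (0 : Fin 3) (1 : ℝ) + (Y 0) • EuclideanSpace.single (1 : Fin 3) (1 : ℝ))‖ ≤ ‖Y‖ := norm_cross_le Y
  have hP := norm_nonneg (fderiv ℝ V x)
  have hW := norm_nonneg (curl V x)
  have hY := norm_nonneg Y
  have hDω : ‖fderiv ℝ V x (curl V x)‖ ≤ ‖fderiv ℝ V x‖ * ‖curl V x‖ := (fderiv ℝ V x).le_opNorm _
  have hDB : ‖fderiv ℝ V x ((-Y 1) • EuclideanSpace.single (0 : Fin 3) (1 : ℝ) + (Y 0) • EuclideanSpace.single (1 : Fin 3) (1 : ℝ))‖ ≤ ‖fderiv ℝ V x‖ * ‖Y‖ := ((fderiv ℝ V x).le_opNorm _).trans (mul_le_mul_of_nonneg_left hB hP)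
  have hω2 : |curl V x 2| ≤ ‖curl V x‖ := abs_apply_le_norm _ 2
  have hH : ‖Y - (Y 2) • EuclideanSpace.single (2 : Fin 3) (1 : ℝ)‖ ≤ 2 * ‖Y‖ := norm_horizontalPart_le _
  have t1 : |⟪((-Y 1) • EuclideanSpace.single (0 : Fin 3) (1 : ℝ) + (Y 0) • EuclideanSpace.single (1 : Fin 3) (1 : ℝ)), fderiv ℝ V x (curl V x)⟫| ≤ ‖Y‖ * (‖fderiv ℝ V x‖ * ‖curl V x‖) :=
    (abs_real_inner_le_norm _ _).trans (mul_le_mul hB hDω (norm_nonneg _) hY)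
  have t2 : |curl V x 2 * ⟪curl V x, Y - (Y 2) • EuclideanSpace.single (2 : Fin 3) (1 : ℝ)⟫| ≤ ‖curl V x‖ * (‖curl V x‖ * (2 * ‖Y‖)) := by
    rw [abs_mul]
    exact mul_le_mul hω2 ((abs_real_inner_le_norm _ _).trans (mul_le_mul_of_nonneg_left hH hW)) (abs_nonneg _) hW
  have t3 : |⟪curl V x, fderiv ℝ V x ((-Y 1) • EuclideanSpace.single (0 : Fin 3) (1 : ℝ) + (Y 0) • EuclideanSpace.single (1 : Fin 3) (1 : ℝ))⟫| ≤ ‖curl V x‖ * (‖fderiv ℝ V x‖ * ‖Y‖) :=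
    (abs_real_inner_le_norm _ _).trans (mul_le_mul_of_nonneg_left hDB hW)
  calc |(⟪((-Y 1) • EuclideanSpace.single (0 : Fin 3) (1 : ℝ) + (Y 0) • EuclideanSpace.single (1 : Fin 3) (1 : ℝ)), fderiv ℝ V x (curl V x)⟫ + curl V x 2 * ⟪curl V x, Y - (Y 2) • EuclideanSpace.single (2 : Fin 3) (1 : ℝ)⟫ + ⟪curl V x, fderiv ℝ V x ((-Y 1) • EuclideanSpace.single (0 : Fin 3) (1 : ℝ) + (Y 0) • EuclideanSpace.single (1 : Fin 3) (1 : ℝ))⟫)|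
      ≤ |⟪((-Y 1) • EuclideanSpace.single (0 : Fin 3) (1 : ℝ) + (Y 0) • EuclideanSpace.single (1 : Fin 3) (1 : ℝ)), fderiv ℝ V x (curl V x)⟫| + |curl V x 2 * ⟪curl V x, Y - (Y 2) • EuclideanSpace.single (2 : Fin 3) (1 : ℝ)⟫| +
          |⟪curl V x, fderiv ℝ V x ((-Y 1) • EuclideanSpace.single (0 : Fin 3) (1 : ℝ) + (Y 0) • EuclideanSpace.single (1 : Fin 3) (1 : ℝ))⟫| :=
        (abs_add_le _ _).trans (add_le_add (abs_add_le _ _) le_rfl)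
    _ ≤ _ := by nlinarith [t1, t2, t3]

/-! ## 2. The `g″`-cross densities of the `Z′`-line -/

/-- **`‖∂_wB‖ ≤ ‖∂_wV‖`** for the cross field `B = (−V₁, V₀, 0)` of a differentiable `V`. [folklore] -/
theorem norm_fderiv_crossField_apply_le (hV : Differentiable ℝ V) (x w : EuclideanSpace ℝ (Fin 3)) :
    ‖fderiv ℝ (fun z : EuclideanSpace ℝ (Fin 3) => (-V z 1) • EuclideanSpace.single (0 : Fin 3) (1 : ℝ) + (V z 0) • EuclideanSpace.single (1 : Fin 3) (1 : ℝ)) x w‖ ≤ ‖fderiv ℝ V x w‖ := by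
  rw [crossField_eq_comp V, ((ContinuousLinearMap.hasFDerivAt _).comp x (hV x).hasFDerivAt).fderiv, ContinuousLinearMap.comp_apply]
  exact (ContinuousLinearMap.le_opNorm _ _).trans (mul_le_of_le_one_left (norm_nonneg _) norm_crossCLM_le_one)

/-- **`|⟪∂ᵤω, ∂_wB⟫| ≤ ‖∂ᵤω‖‖∂_wV‖`** (the densities `g″⟪∂₂ω,∂₂B⟫`, `Σᵢ g″⟪∂ᵢω,∂ᵢB⟫` of `Ĉ₁`). [folklore] -/
theorem abs_inner_fderiv_curl_fderiv_crossField_le (hV : Differentiable ℝ V) (x u w : EuclideanSpace ℝ (Fin 3)) :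
    |⟪fderiv ℝ (curl V) x u, fderiv ℝ (fun z : EuclideanSpace ℝ (Fin 3) => (-V z 1) • EuclideanSpace.single (0 : Fin 3) (1 : ℝ) + (V z 0) • EuclideanSpace.single (1 : Fin 3) (1 : ℝ)) x w⟫| ≤ ‖fderiv ℝ (curl V) x u‖ * ‖fderiv ℝ V x w‖ :=
  (abs_real_inner_le_norm _ _).trans (mul_le_mul_of_nonneg_left (norm_fderiv_crossField_apply_le hV x w) (norm_nonneg _))

/-- **`|(∂₂ω)₀(∂₁V)₂ − (∂₂ω)₁(∂₀V)₂| ≤ 2‖∂₂ω‖‖DV‖`** (the `g″`-density of `sum_inner_slideCoeffDeriv`). [folklore] -/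
theorem abs_slideCoeff_density_le (x : EuclideanSpace ℝ (Fin 3)) :
    |fderiv ℝ (curl V) x (EuclideanSpace.single (2 : Fin 3) (1 : ℝ)) 0 * fderiv ℝ V x (EuclideanSpace.single (1 : Fin 3) (1 : ℝ)) 2 - fderiv ℝ (curl V) x (EuclideanSpace.single (2 : Fin 3) (1 : ℝ)) 1 * fderiv ℝ V x (EuclideanSpace.single (0 : Fin 3) (1 : ℝ)) 2| ≤
      2 * ‖fderiv ℝ (curl V) x (EuclideanSpace.single (2 : Fin 3) (1 : ℝ))‖ * ‖fderiv ℝ V x‖ := by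
  have n0 : ‖(EuclideanSpace.single (0 : Fin 3) (1 : ℝ) : EuclideanSpace ℝ (Fin 3))‖ = 1 := by rw [PiLp.norm_single, norm_one]
  have n1 : ‖(EuclideanSpace.single (1 : Fin 3) (1 : ℝ) : EuclideanSpace ℝ (Fin 3))‖ = 1 := by rw [PiLp.norm_single, norm_one]
  have a0 : |fderiv ℝ (curl V) x (EuclideanSpace.single (2 : Fin 3) (1 : ℝ)) 0| ≤ ‖fderiv ℝ (curl V) x (EuclideanSpace.single (2 : Fin 3) (1 : ℝ))‖ := abs_apply_le_norm _ 0
  have a1 : |fderiv ℝ (curl V) x (EuclideanSpace.single (2 : Fin 3) (1 : ℝ)) 1| ≤ ‖fderiv ℝ (curl V) x (EuclideanSpace.single (2 : Fin 3) (1 : ℝ))‖ := abs_apply_le_norm _ 1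
  have b1 : |fderiv ℝ V x (EuclideanSpace.single (1 : Fin 3) (1 : ℝ)) 2| ≤ ‖fderiv ℝ V x‖ :=
    (abs_apply_le_norm _ 2).trans (by simpa [n1] using (fderiv ℝ V x).le_opNorm (EuclideanSpace.single (1 : Fin 3) (1 : ℝ)))
  have b0 : |fderiv ℝ V x (EuclideanSpace.single (0 : Fin 3) (1 : ℝ)) 2| ≤ ‖fderiv ℝ V x‖ :=
    (abs_apply_le_norm _ 2).trans (by simpa [n0] using (fderiv ℝ V x).le_opNorm (EuclideanSpace.single (0 : Fin 3) (1 : ℝ)))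
  refine (abs_sub _ _).trans ?_
  rw [abs_mul, abs_mul]
  nlinarith [mul_le_mul a0 b1 (abs_nonneg _) (norm_nonneg _), mul_le_mul a1 b0 (abs_nonneg _) (norm_nonneg _)]

end ExtremiserLiouville

end Summit.NavierStokesRegularity.NavierStokesRegularity.Theorems

end
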